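import Literature.Computability.Cryptography.PerfectRandomizedEncodingPolyMap
import Literature.Computability.Complexity.RandomizingPolynomialsBDD
import HarnessLib

/-!
# The degree-3 perfect randomized encoding of branching programs (Ishai–Kushilevitz / AIK)

**Theorem** [Applebaum–Ishai–Kushilevitz 2006, Lemma 4.15 with Lemma 4.9; Ishai–Kushilevitz 2002,
§3; Dvir–Gutfreund–Rothblum–Vadhan 2010, Thm 4.5].  A function `f : {0,1}ⁿ → {0,1}^ℓ` whose output
bits are computed by deterministic branching programs `B₁, …, B_ℓ` of sizes `s₁, …, s_ℓ` has a
PERFECT RANDOMIZED ENCODING by a polynomial map of DEGREE `3` over `F₂` with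
`m = ∑ᵢ sᵢ(sᵢ + 3)/2` random bits, `∑ᵢ (sᵢ + 1)(sᵢ + 2)/2` output bits and blowup `2^m`; in
particular its output entropy on a uniform input is `H(f(U_n)) + m`.

This file assembles the statement at the level of the tree's sparse polynomial maps `PolyMapF2`
and the combinatorial notion `IsPerfectRandomizedEncoding` from the valuation-level construction
of `Literature/Computability/Complexity/RandomizingPolynomialsBDD.lean` (files IX–XI of the
randomizing-polynomials series) and the bridge `PerfectRandomizedEncodingPolyMap.lean`:

* `toInput x` — a point `x ∈ F₂ⁿ` read as a Boolean assignment; `fnList Bs` — the list of the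
  functions of the programs `Bs : List (Σ s, BDD (Fin n) s)`;
* `freshBDDs Bs = ∑ pos sᵢ sᵢ` — the number of random bits; `encodeBDDsMap n Bs : PolyMapF2 (n + m)`
  — the encoding as a `Fin`-indexed sparse map;
* `degLE_three_encodeBDDsMap` — degree `≤ 3`;
* `isPerfectRandomizedEncoding_encodeBDDsMap` — **it is a perfect randomized encoding of
  `x ↦ fnList Bs (toInput x)` with blowup `2^m`** (DGRV Def. 4.1 / AIK Def. 4.6);
* `entropy_encodeBDDsMap` — `H = H(f(U_n)) + m` (DGRV Claim 4.4), the identity consumed by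
  entropy-approximation reductions (`PEA`).

NOT here: polynomial-time computability of `Bs ↦ encodeBDDsMap` from a Boolean encoding of the
programs (the construction is explicit and primitive recursive; an `FP` proof in the style of
`DegreeThreeEncodingFP/MapFP.lean` is left to a separate file), mod-2 / nondeterministic
branching programs, the locality-4 (NC⁰) version (AIK §4.3, Construction 4.16).

## References

* B. Applebaum, Y. Ishai, E. Kushilevitz, *Cryptography in NC⁰*, SIAM J. Comput. 36 (2006), §4.3,
  Lemma 4.15 (degree-3 perfect encoding of a mod-2 BP), Lemma 4.9 (concatenation).
* Y. Ishai, E. Kushilevitz, ICALP 2002, §3.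
* Z. Dvir, D. Gutfreund, G. N. Rothblum, S. Vadhan, ECCC TR10-160 (2010), Thm 4.5, Claim 4.4.
-/

namespace Literature.Computability.Cryptography

open Finset Literature.InformationTheory.Entropy Literature.Computability.Complexity
open Literature.Computability.Complexity.RandPoly

variable {n : ℕ}

/-! ### Inputs and the encoded function -/

/-- A point of `F₂ⁿ` read as a Boolean assignment of the `n` variables. [folklore] -/
def toInput (x : Fin n → ZMod 2) : Fin n → Bool := fun i => decide (x i = 1)

/-- `toInput` is the input read off the valuation of `x` (variable `i` at position `i`). [folklore] -/
theorem inputOf_valOf (x : Fin n → ZMod 2) : inputOf Fin.val (valOf x) = toInput x := by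
  funext i
  simp [inputOf, toInput]

/-- The list of Boolean functions computed by a list of BDDs. [folklore] -/
def fnList (Bs : List (Σ s, BDD (Fin n) s)) (z : Fin n → Bool) : List Bool :=
  Bs.map fun B => B.2.fn z

/-! ### The encoding as a `Fin`-indexed sparse polynomial map -/

/-- The number of random bits: `∑ᵢ pos sᵢ sᵢ = ∑ᵢ sᵢ(sᵢ + 3)/2`. [cite: ApplebaumIshaiKushilevitz2006, Lemma 4.15] -/
def freshBDDs (Bs : List (Σ s, BDD (Fin n) s)) : ℕ := (Bs.map fun B => pos B.1 B.1).sum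

/-- The counter of the list encoding started at `n` ends at `n + freshBDDs Bs`. [folklore] -/
theorem encodeBDDs_fst_eq (Bs : List (Σ s, BDD (Fin n) s)) :
    (encodeBDDs Fin.val n Bs).1 = n + freshBDDs Bs :=
  encodeBDDs_fst Fin.val n Bs

/-- The variables of the list encoding are below `n + freshBDDs Bs`. [folklore] -/
theorem varsIn_encodeBDDs (Bs : List (Σ s, BDD (Fin n) s)) :
    VarsIn (fun y => y < n + freshBDDs Bs) (encodeBDDs Fin.val n Bs).2 := by
  intro q hq μ hμ y hy
  rcases (mem_encodeBDDs hq hμ).2 y hy with ⟨i, rfl⟩ | h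
  · exact Nat.lt_add_right _ i.isLt
  · rw [encodeBDDs_fst_eq] at h
    exact h.2

/-- **The degree-3 encoding of a list of BDDs over the variables `Fin n`**, as a sparse polynomial
map in `n + m` variables (`m = freshBDDs Bs` random bits appended to the input).
[cite: ApplebaumIshaiKushilevitz2006, Lemma 4.15] -/
def encodeBDDsMap (n : ℕ) (Bs : List (Σ s, BDD (Fin n) s)) : PolyMapF2 (n + freshBDDs Bs) :=
  toFinMap (n + freshBDDs Bs) (encodeBDDs Fin.val n Bs).2 (varsIn_encodeBDDs Bs)

/-- The number of output bits: `∑ᵢ (sᵢ + 1)(sᵢ + 2)/2` (one per pair `a ≤ b ≤ sᵢ`). [folklore] -/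
theorem length_encodeBDDsMap (n : ℕ) (Bs : List (Σ s, BDD (Fin n) s)) :
    (encodeBDDsMap n Bs).length = (Bs.map fun B => (pairsLE B.1).length).sum := by
  unfold encodeBDDsMap
  have h : ∀ (m : ℕ) (O : List (List (List ℕ))) (hO : VarsIn (fun y => y < m) O),
      (toFinMap m O hO).length = O.length := fun m O hO => by
    unfold toFinMap
    rw [List.length_pmap]
  rw [h]
  suffices ∀ k, (encodeBDDs Fin.val k Bs).2.length = (Bs.map fun B => (pairsLE B.1).length).sum from this n
  intro k
  induction Bs generalizing k with
  | nil => rfl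
  | cons B Bs ih => simp [encodeBDDs, length_encodeBDD, ih]

/-- **Degree `3`.** [cite: ApplebaumIshaiKushilevitz2006, Lemma 4.15] -/
theorem degLE_three_encodeBDDsMap (n : ℕ) (Bs : List (Σ s, BDD (Fin n) s)) :
    (encodeBDDsMap n Bs).DegLE 3 := by
  intro p hp μ hμ
  obtain ⟨q, hq, ν, hν, hμν⟩ := mem_toFinMap hp hμ
  have := (mem_encodeBDDs hq hν).1
  rw [← hμν, List.length_map] at this
  exact this

/-- **AIK's theorem: the degree-3 encoding of branching programs is a perfect randomized encoding**
of the list of computed bits, with blowup `2^m`, `m` the number of random bits (so each `enc x` is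
injective in the randomness: stretch-preserving). [cite: ApplebaumIshaiKushilevitz2006, Lemma 4.15] -/
theorem isPerfectRandomizedEncoding_encodeBDDsMap (n : ℕ) (Bs : List (Σ s, BDD (Fin n) s)) :
    IsPerfectRandomizedEncoding (fun x : Fin n → ZMod 2 => fnList Bs (toInput x))
      (fun (x : Fin n → ZMod 2) (r : Fin (freshBDDs Bs) → ZMod 2) =>
        (encodeBDDsMap n Bs).eval (Fin.append x r))
      (2 ^ freshBDDs Bs) := by
  have hPE := perfExt_encodeBDDs (var := Fin.val) (n := n) (fun i => i.isLt) Bs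
  rw [encodeBDDs_fst_eq] at hPE
  have hg : ∀ v w : ℕ → ZMod 2, AgreeBelow n v w →
      (Bs.map fun B => B.2.fn (inputOf Fin.val v)) = Bs.map fun B => B.2.fn (inputOf Fin.val w) :=
    fun v w hvw => by rw [inputOf_congr (fun i : Fin n => i.isLt) hvw]
  have h := isPerfectRandomizedEncoding_toFinMap hPE (varsIn_encodeBDDs Bs) hg
  refine h.of_fiber_iff fun x x' => ?_
  simp only [fnList, inputOf_valOf]

/-- **The entropy of the encoding exceeds the entropy of the encoded function by exactly the
randomness length**: `H(encodeBDDsMap(U_{n+m})) = H(f(U_n)) + m`.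
[cite: DvirGutfreundRothblumVadhan2010, Claim 4.4] -/
theorem entropy_encodeBDDsMap (n : ℕ) (Bs : List (Σ s, BDD (Fin n) s)) :
    (encodeBDDsMap n Bs).entropy =
      mapEntropy univ (fun x : Fin n → ZMod 2 => fnList Bs (toInput x)) + freshBDDs Bs :=
  (encodeBDDsMap n Bs).entropy_eq_add_of_isPerfectRandomizedEncoding
    (isPerfectRandomizedEncoding_encodeBDDsMap n Bs)

/-! ### A worked instance (non-vacuity): the OBDD of `x₀ ∧ x₁` -/

/-- The encoding of the 4-node OBDD of `x₀ ∧ x₁` uses `14 = 4·7/2` random bits. [folklore] -/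
example : freshBDDs [⟨4, BDD.andOBDD⟩] = 14 := by decide

/-- … has `15 = 5·6/2` output bits. [folklore] -/
example : (encodeBDDsMap 2 [⟨4, BDD.andOBDD⟩]).length = 15 := by
  rw [length_encodeBDDsMap]; decide

/-- … is a perfect randomized encoding of `x ↦ [x₀ ∧ x₁]` with blowup `2¹⁴`, of degree `3`, and
has output entropy `H(x₀ ∧ x₁) + 14`. [cite: ApplebaumIshaiKushilevitz2006, Lemma 4.15] -/
example :
    IsPerfectRandomizedEncoding (fun x : Fin 2 → ZMod 2 => [(toInput x 0 && toInput x 1)])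
      (fun (x : Fin 2 → ZMod 2) (r : Fin 14 → ZMod 2) =>
        (encodeBDDsMap 2 [⟨4, BDD.andOBDD⟩]).eval (Fin.append x r)) (2 ^ 14) ∧
    (encodeBDDsMap 2 [⟨4, BDD.andOBDD⟩]).DegLE 3 ∧
    (encodeBDDsMap 2 [⟨4, BDD.andOBDD⟩]).entropy =
      mapEntropy univ (fun x : Fin 2 → ZMod 2 => [(toInput x 0 && toInput x 1)]) + 14 := by
  have hf : (fun x : Fin 2 → ZMod 2 => fnList [⟨4, BDD.andOBDD⟩] (toInput x)) =
      fun x => [(toInput x 0 && toInput x 1)] := by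
    funext x
    simp [fnList, BDD.andOBDD_fn]
  have h1 := isPerfectRandomizedEncoding_encodeBDDsMap 2 [⟨4, BDD.andOBDD⟩]
  have h3 := entropy_encodeBDDsMap 2 [⟨4, BDD.andOBDD⟩]
  rw [hf] at h1 h3
  exact ⟨h1, degLE_three_encodeBDDsMap 2 _, by rw [h3]; norm_num [freshBDDs, pos, tri]⟩

end Literature.Computability.Cryptography
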